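import Literature.NumberTheory.EllipticCurves.AnticyclotomicSignedCompactSelmer
import HarnessLib

/-!
# Λ-submodules of finite index of the anticyclotomic plus/minus Selmer groups (Hatley–Lei–Vigni
# 2022, §4–§6): the plus/minus Mordell–Weil groups `E^±(K_n)`, their Kummer images `ℋ^±_n[p^m]`,
# the plus/minus Heegner submodules `𝓔^±`, `𝔈^±_{m,n}`, the plus/minus (relative) Shafarevich–Tate
# groups, the universal norms `US^±_p(E/K)`, hypotheses (Norm) / (mod p) / (Cong), and the theorems
# 5.15 (= Thm. 1.1), Cor. 5.9, Prop. 5.7, Prop. 6.2, Thm. 6.3 (= Thm. 1.2) as named facts — printed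
# for ODD `p`, hence usable at `p = 3`

Topic `Literature/NumberTheory/EllipticCurves`; namespace `Literature.NumberTheory.EllipticCurves.AcSigned`
(continuing the object namespace of `AnticyclotomicSignedSelmer.lean` — the DISCRETE carriers, the duals
`X`, the `Setting` — and of `AnticyclotomicSignedCompactSelmer.lean` — the finite-level groups
`Sel^{𝓛}_{p^m}(E/K_n) = selmerTorsion`, the compact `Sel^{𝓛}(K_n, T) = compactSelmerLayer`, the
`Λ^ac`-adic `selmerLambdaAdic`, the maps `θ_{n,m} = toInfty`). Cell `pub/bsd-wall` (rung W-ALL of the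
BSD summit), literature-typer seat `bsd-wall-utd-ty1` (gen 7; director-bsd g12 (142)(e): "type the
± / signed anticyclotomic Selmer carriers at `p = 3` for `a_p = 0` (Kobayashi 2003 §8; B.-D. Kim;
Kitajima–Otsuki 2018; Matar RNT 2021; Castella–Wan 2024 §4–5; HLV 2022)"), `--supports`
stmt-BirchSwinnertonDyer-23594 (crux `TwinSplitIMCAtThreeGoodSSApZero`, route `UniversalToricDescent`;
the live cruxes of that column are ♭C₀_T stmt-…-27173 and ♭B′ stmt-…-27401). HONEST FRAMING:
DEFINITIONS with bodies + PROVED unfolding lemmas + `Prop`-valued hypothesis predicates + FIVE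
statement-only named facts (`def … : Prop`, D-0014; nothing is asserted, no `_holds`, no instance, no
notation). The generations g0–g6 of this seat typed the carriers and Hatley–Lei–Vigni's Def. 3.4,
Remark 3.1/3.5, Lemma 3.7, Lemma 3.8, Prop. 3.2 (a), Prop. 3.9; the module docstring of
`AnticyclotomicSignedSelmer.lean` lists "Hatley–Lei–Vigni Thm. 1.1 (hypothesis (mod `p`) is phrased with
the `±` Heegner points): typable later on the same carriers" — this file does that. Typed ≠ proved ≠
endorsed; BSD is not advanced by this file; no crux moves.

## What is typed here

1. (Part 1) The GLOBAL layer objects: `E(K_n) = E(K̄)^{Gal(K̄/K_n)}` (`mwLayer`), the trace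
   `Tr_{n/m} : E(K̄) → E(K̄)` (`mwTrace`, a sum over coset representatives, the global twin of
   `Kobayashi2003.localTraceOfEmb`) and Hatley–Lei–Vigni's **plus/minus Mordell–Weil groups**
   `E^±(K_n) = {P ∈ E(K_n) | Tr_{n/m+1} P ∈ E(K_m) for all m ∈ S^±_n, m < n}` (Def. 4.1;
   `signedMWLayer`), with unfolding lemmas.
2. (Part 2) The Kummer images: `ℋ^±_∞ = ⋃_n E^±(K_n) ⊗ ℚ_p/ℤ_p ⊂ H¹(K_∞, E[p^∞])` (§4.1, via the
   tree's Kummer classes `WeierstrassCurve.kummerClassOver` and `θ_{n,m}`; `signedMWKummerInfty`), the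
   finite-level groups `ℋ^±_n[p^m] ⊂ H¹(K_n, E[p^m])` (`signedMWKummerLayer`, the PULLBACK along
   `θ_{n,m}` — flag `HLV-pullback`), the **plus/minus `p^m`-Shafarevich–Tate groups**
   `Ш^±_{p^m}(E/K_n) = Sel^±_{p^m}(E/K_n)/ℋ^±_n[p^m]` (Def. 5.11; `signedSha`, flag `HLV-Rem-4.2`) and
   the vanishing of the RELATIVE groups `Ш^±_{p^m}(E, K_{n+1}/K_n) = ker(Ш^±_{p^m}(E/K_n) →
   Ш^±_{p^m}(E/K_{n+1})) = 0` as a predicate (`RelSignedShaVanishes`, unfolded).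
3. (Part 3) The **plus/minus Heegner points** `z^±_n` of a Heegner family along the anticyclotomic
   tower (Def. 4.3, on the tree's `HeegnerFamily`; `signedHeegnerPoint`), the `R_{m,n}`-modules
   `𝓔^±_{m,n} ⊂ Sel^±_{p^m}(E/K_n)` generated by `z^±_n` (`signedHeegnerModuleLayer`),
   `𝓔^±_∞ = lim→_m 𝓔^±_{m,m} ⊂ Sel^±_{p^∞}(E/K_∞)` (`signedHeegnerModuleInfty`) and
   `𝔈^±_{m,n} = (𝓔^±_∞)^{Gal(K_∞/K_n)}[p^m]` (`frakE`, pullback; §4.2).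
4. (Part 4) The **universal norms** `US^±_p(E/K) ⊂ S^±_p(E/K) = lim←_m Sel^±_{p^m}(E/K)` (§5.2, as the
   level-`0` components of the `Λ^ac`-adic families `selmerLambdaAdic` — flag `US-as-limit`), the
   predicates "`US^±_p(E/K)` is free of rank one over `ℤ_p`", "`S^±_p(E/K)/US^±_p(E/K)` has no
   `ℤ_p`-torsion", "`Sel^±_{p^∞}(E/K_∞)` has no proper `Λ`-submodule of finite index", and the
   reflexive defect `T₂(M) = coker(M → M^{++})` of [Jan] behind the invariant `c(M)` (Def. 6.1).
5. (Part 5) The hypotheses (Tam), (Norm), (mod `p`), (Cong) of §1.2 as `Prop`s (`LocalNormsSurjective`,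
   `ModP`, `ModPCongruent`).
6. (Part 6) FIVE NAMED FACTS (statements only): `hatleyLeiVigni2022_thm515_noFiniteIndex` (Thm. 1.1 =
   Thm. 5.15), `hatleyLeiVigni2022_cor59_noFiniteIndex_iff_saturated` (Cor. 5.9),
   `hatleyLeiVigni2022_prop57_compactSigned_equiv_dual` (Prop. 5.7),
   `hatleyLeiVigni2022_prop62_dual_mod_p` (Prop. 6.2), `hatleyLeiVigni2022_thm63_invariants_congruent`
   (Thm. 1.2 = Thm. 6.3).

## Source, VERBATIM (author TeX `paper:arxiv-2003.10301` = J. Hatley, A. Lei, S. Vigni, Manuscripta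
## Math. 167 (2022) 589–612 [HatleyLeiVigni2022]; numbering of the arXiv version; read 2026-08-28)

§1.1: "`p` will denote an odd prime number. Let `E/ℚ` be an elliptic curve of conductor `N` with good
supersingular reduction at `p` and `a_p(E) = 0` … `K` … an imaginary quadratic field such that all the
primes dividing `pN` split in `K` … `K_∞` the anticyclotomic `ℤ_p`-extension of `K` … We assume that the
two primes of `K` above `p` are totally ramified in `K_∞`; this … holds if `p` does not divide the class
number of `K`." §1.2: "(Heeg) Every prime number dividing `Np` splits in … `K` … (Tam) … the prime `p`
does not divide `#(E/E⁰)` … (Norm) For an elliptic curve `E/ℚ` satisfying (Tam), the local norm maps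
`E(K_{n,v}) → E(K_v)` are surjective for all `n ≥ 1` and all primes of `K` that do not divide `p` …
(mod `p`) For an elliptic curve `E/ℚ` satisfying both `a_p(E) = 0` and (Norm), we have `𝔈^±_n ≠ 0`
and `Ш^±_p(E, K_{n+1}/K_n) = 0` for all `n ∈ ℕ` … (Cong) Given two elliptic curves `E_1/ℚ` and
`E_2/ℚ`, both of which satisfy (mod `p`), there is an isomorphism `E_1[p] ≃ E_2[p]` of
`G_ℚ`-modules … (Cong) ⇒ (mod `p`) ⇒ (Norm) ⇒ (Tam)." §2.2: "`Λ := lim← ℤ_p[G_n] = ℤ_p⟦G_∞⟧` …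
`γ_∞ ↦ 1 + X`." §3.1: "`S_n^+ := {0, 1, …, n} ∩ 2ℤ`; `S_n^- := {0, 1, …, n} ∩ (2ℤ+1)`"; **(3.1)**,
**Def. 3.4**, **Remark 3.5/3.6** (quoted in `AnticyclotomicSignedCompactSelmer.lean`; "If `m = 1`, then
we omit the superscript and simply write, e.g., `Sel^±_p(E/K_n)`"). §4.1: "**Definition 4.1.** The
plus/minus Mordell–Weil groups of `E` over `K_n` are `E^±(K_n) := {P ∈ E(K_n) | Tr_{n/m+1}(P) ∈
E(K_m) for all m ∈ S_n^± with m < n}`. … `ℋ^±_∞ := ⋃_{n≥0} E^±(K_n) ⊗ ℚ_p/ℤ_p`, `ℋ^±_n :=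
(ℋ^±_∞)^{Gal(K_∞/K_n)}`. **Remark 4.2.** The `Λ`-module `ℋ^±_∞` (respectively, `ℋ^±_n`) may be
identified with a submodule of `Sel^±_{p^∞}(E/K_∞)` (respectively, `Sel^±_{p^∞}(E/K_n)`) via the usual
Kummer map … we may view `ℋ^±_n[p^m]` as a `Λ`-submodule of `Sel^±_{p^m}(E/K_n)`." §4.2: "Let
`{z_n ∈ E(K_n)}_{n≥1}` be a compatible family of Heegner points as in [LV-BUMI] … **Definition 4.3.**
The plus/minus Heegner points are `z^+_n := z_n` if `n` is even, `z_{n−1}` if `n` is odd; `z^-_n :=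
z_{n−1}` if `n` is even, `z_n` if `n` is odd. … `tr_{K_1/K_0}(z^-_1) = ((p−1)/2) z^-_0 = ((p−1)/2) z_0`.
In particular, … `z^±_m ∈ E^±(K_m)`. … `R_{m,n} := (ℤ/p^mℤ)[G_n]` … we define `𝓔^±_{m,n}` to be the
`R_{m,n}`-submodule of `Sel^±_{p^m}(E/K_n)` generated by `z^±_n` … `𝓔^±_∞ := lim→_m 𝓔^±_{m,m} ⊂
Sel^±_{p^∞}(E/K_∞)` … `𝓗^±_∞ := (𝓔^±_∞)^∨` … `𝔈^±_{m,n} := (𝓔^±_∞)^{Gal(K_∞/K_n)}[p^m]`. When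
`m = 1`, we shall omit the index `m` … **Proposition 4.4/4.5** ([LV-BUMI]): `𝓗^±_∞` is free of rank
one over `Λ`." §5.1 "Throughout … We also assume that the hypothesis (Tam) holds." §5.2: "`S^±_p(E/K_n)
:= lim←_m Sel^±_{p^m}(E/K_n)` … `cor_{K_{n'}/K_n} : S^±_p(E/K_{n'}) → S^±_p(E/K_n)` … `Ŝ^±_p(E/K_∞)
:= lim←_n S^±_p(E/K_n)` … **Proposition 5.7.** There is a canonical isomorphism of `Λ`-modules
`Ŝ^±_p(E/K_∞) ≃ Hom_Λ(Sel^±_{p^∞}(E/K_∞)^∨, Λ)`. [Proof: "as in the proof of [Perrin-Riou],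
replacing the control theorem … with Proposition 3.9."] … The universal norm submodule of `S^±_p(E/K)`
is `US^±_p(E/K) := ⋂_{n≥1} cor_{K_n/K}(S^±_p(E/K_n)) ⊂ S^±_p(E/K)`. **Theorem 5.8.** [perfect pairing
`S^±_p(E/K)/US^±_p(E/K) × Sel^±_{p^∞}(E/K_∞)_{G_∞} → G_∞ ⊗ ℚ_p/ℤ_p`, under (Norm) via Prop. 5.6]
**Corollary 5.9.** The `Λ`-module `Sel^±_{p^∞}(E/K_∞)` admits no proper `Λ`-submodule of finite
index if and only if `S^±_p(E/K)/US^±_p(E/K)` has no `ℤ_p`-torsion." §5.3: "**Definition 5.11.**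
The plus and minus `p^m`-Shafarevich–Tate groups of `E` over `K_n` are `Ш^±_{p^m}(E/K_n) :=
Sel^±_{p^m}(E/K_n)/ℋ^±_n[p^m]`. The relative plus and minus `p^m`-Shafarevich–Tate groups are
`Ш^±_{p^m}(E, K_{n+1}/K_n) := ker(Ш^±_{p^m}(E/K_n) → Ш^±_{p^m}(E/K_{n+1}))`, where the map on the
right is induced by restriction. … **Lemma 5.13.** `S^±_p(E/K) = lim←_m ℋ^±_0[p^m]` [proof: "…
`Ш_{p^m}(E/K)` is finite and bounded independently of `m` ([Kol-Euler])"] … **Theorem 5.15.** Suppose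
that hypothesis (mod `p`) is satisfied. Then `US^±_p(E/K)` is free of rank one over `ℤ_p` and the
`Λ`-module `Sel^±_{p^∞}(E/K_∞)` admits no proper `Λ`-submodule of finite index." [proof: "`E(K)` is
`p`-torsion free … by [LV-BUMI] (see also [CastellaWan]), the `Λ`-module `Sel^±_{p^∞}(E/K_∞)^∨` has
rank one. Combining this with Proposition 5.7 …"] §6.2: "`M ∼ Λ^{⊕r} ⊕ ⊕_i Λ/(p^{a_i}) ⊕ ⊕_j
Λ/(F_j^{n_j})` … `μ(M) := ∑ a_i`, `λ(M) := ∑ n_j deg(F_j)` … `0 → M_tor → M → M^{++} → T_2(M) → 0`,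
where `M^{++}` is the reflexive hull of `M` … `T_2(M)` is finite [Jan]. **Definition 6.1.** … `c(M)` …
the unique integer satisfying `|T_2(M)[p]| = |𝔽_p|^{c(M)}` … `c_±(E) = c(M)` for
`M = Sel^±_{p^∞}(E/K_∞)^∨`." §6.3: "we fix elliptic curves `E_1` and `E_2` with square-free conductors
`N_1` and `N_2`, respectively, such that `E_1[p] ≃ E_2[p]` as `G_ℚ`-modules and `a_p(E_i) = 0` … the
field `K`, the prime `p`, and the product of the conductors `N_1N_2` satisfy (Heeg) … both curves satisfy
… (Tam). … `𝒳^±(E_i) = Sel^±_{p^∞}(E_i/K_∞)^∨` … **Proposition 6.2.** Suppose `E_1/ℚ` and `E_2/ℚ`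
are elliptic curves satisfying `a_p(E_i) = 0` and (Tam) for `i = 1, 2` and that `E_1[p] ≃ E_2[p]` as
`G_ℚ`-modules. Assume further that … (Heeg) holds. Then we have an isomorphism `𝒳^±(E_1)/p ≃
𝒳^±(E_2)/p`. **Theorem 6.3.** Let `E_1/ℚ` and `E_2/ℚ` be elliptic curves for which the hypotheses
(Heeg) and (Cong) hold. Then `μ_±(E_1) = 0 ⟺ μ_±(E_2) = 0`. Suppose that `μ_±(E_1) = μ_±(E_2) = 0`.
Then `λ_±(E_1) + c_±(E_1) = λ_±(E_2) + c_±(E_2)`." [proof: "By [LV-BUMI], both `𝒳_±(E_1)` and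
`𝒳_±(E_2)` have `Λ`-rank 1, so we may apply [hat-lei2] … we know from Theorem 5.15 (and duality) that
each `𝒳^±(E_i)` contains no non-trivial finite `Λ`-submodules, so we may apply [MRL2]"]. §1
(p. 3): "these Selmer groups have no proper `Λ`-submodules of finite index or, equivalently, … their
Pontryagin duals have no nontrivial finite `Λ`-submodules".

## READING FLAGS (informational — where the transcription is a reading, not a printed sentence)

* `HLV-rank-one-input` (THE point a consumer at `p = 3` must know): the PRINTED statements of
  Thm. 5.15 and Thm. 6.3 carry only §1.1–1.2's hypotheses (`p` odd), but their printed PROOFS take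
  "`Sel^±_{p^∞}(E/K_∞)^∨` has `Λ`-rank one" from [LV-BUMI] = Longo–Vigni 2019 (standing Assumption 1.1:
  `p ≥ 5`, `ρ_{E,p}` surjective, `N > 3`, non-CM; tree fact
  `AcSigned.longoVigni2019_thm14_signedSelmerDual_rank_one`, `5 ≤ p` verbatim) "(see also [CastellaWan])"
  (`p > 3`), and Lemma 5.13 takes "`Ш_{p^m}(E/K)` finite and bounded independently of `m`" from
  [Kol-Euler] (Kolyvagin: when the basic Heegner point is non-torsion). The facts below therefore
  carry these two inputs as EXPLICIT BINDERS (`hrk`, `hSha`) — the transcription is WEAKER than the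
  printed sentence, never stronger; at `p ≥ 5` under Longo–Vigni's assumptions `hrk` is the tree fact by
  name, and `hSha` is Kolyvagin's theorem; at `p = 3` neither is in print for the `±` carriers.
* `HLV-pullback`: Hatley–Lei–Vigni identify `ℋ^±_{n}[p^m]`, `𝔈^±_{m,n}` — invariants-and-torsion of
  `K_∞`-level groups — with submodules of `H¹(K_n, A_m)` through the isomorphisms
  `H¹(K_n, A_m) ≃ H¹(K_∞, A)^{𝒢_{∞/n}}[p^m]` of Remark 3.1 / Remark 4.2 / Lemma 4.8 (inflation–restriction,
  valid because `E(K_∞)[p] = 0`, Iovita–Pollack Lemma 2.1 = `AcSigned.iovitaPollack2006_lemma21_noPTorsion_top`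
  in the `Setting`). This file DEFINES the finite-level groups as the preimages under
  `θ_{n,m} = AcSigned.toInfty` — literally "the classes of `H¹(K_n, A_m)` whose image lies in the
  `K_∞`-level group" (automatically `𝒢_{∞/n}`-invariant and `p^m`-torsion) —, which is the printed group
  under those isomorphisms and a definite group always.
* `HLV-Rem-4.2`: "`ℋ^±_n[p^m]` as a `Λ`-submodule of `Sel^±_{p^m}(E/K_n)`" (Remark 4.2: global points
  satisfy the local conditions; above `p` the global traces ARE the local traces because the primes above
  `p` are totally ramified in `K_∞/K`) is not formalised: `signedSha` is the quotient of
  `Sel^±_{p^m}(E/K_n)` by the INTERSECTION `ℋ^±_n[p^m] ∩ Sel^±_{p^m}(E/K_n)` (`AddSubgroup.addSubgroupOf`),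
  which is the printed quotient given Remark 4.2.
* `US-as-limit`: `US^±_p(E/K) := ⋂_n cor_{K_n/K}(S^±_p(E/K_n))` is transcribed as the set of level-`0`
  components of the norm-compatible families `selmerLambdaAdic … (sgn ε)` (= `Ŝ^±_p(E/K_∞) = lim←_n
  S^±_p(E/K_n)`, the object of Prop. 5.7, constructed in `AnticyclotomicSignedCompactSelmer.lean` with the
  tree's norm-compatibility convention `res ∘ cor = N_{K_{n+1}/K_n}` of `LambdaAdicSelmerData.proj_norm`):
  for an inverse system of compact groups the image of the limit IS the intersection of the images
  (the standard compactness argument used in the proof of Thm. 5.15: "By compactness, we may find a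
  subsequence … converging"), a docstring identification, not a formalised step.
* `HLV-LV-family`: "a compatible family of Heegner points `{z_n ∈ E(K_n)}` as in [LV-BUMI]" is the
  tree's `HeegnerFamily` (`F.z n = Norm_{K[p^{n+1}]/K_n} P[p^{n+1}] ∈ E(K_n)`, file `HeegnerModuleIndex`;
  cf. the flag `delta-zero` of `AnticyclotomicSignedHeegnerClasses.lean`); the trace relations displayed in
  §4.2 ([Perrin-Riou]) are consequences in print, not re-derived, and `z^-_0 = z_0` (displayed) is the
  value of `signedHeegnerPoint` at `(ε, n) = (−1, 0)`.
* `sign-wise`: (mod `p`) and the conclusions are transcribed PER SIGN `ε` (the printed proof for the sign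
  `±` uses `𝔈^±` and `Ш^±` of the same sign only).
* `mu-lambda-of-torsion`: HLV's `μ(M)`, `λ(M)` of a finitely generated `Λ`-module of rank `r ≥ 0` are
  read off the torsion part of its elementary module (§6.2), i.e. `μ(M) = μ(M_tor)`, `λ(M) = λ(M_tor)`;
  the tree's `muInvariant` (the `(p)`-length) and `lambdaInvariant` (`dim_{ℚ_p} M ⊗ ℚ_p`) are the
  printed numbers on TORSION modules only, so the facts apply them to `Submodule.torsion Λ X` (here
  `X^±` has rank one).
* `c-invariant`: `c(M)` enters as "the `c` with `#T₂(M)[p] = p^c`" (Def. 6.1), with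
  `T₂(M) = coker(M → M^{**})` (`reflexiveDefect`, Mathlib `Module.Dual.eval`); its finiteness ([Jan]) is
  not asserted.
* `square-free`, `Heeg-product`: §6.3's standing "square-free conductors `N_1`, `N_2`" and "(Heeg) for
  `N_1N_2`" are carried verbatim by Prop. 6.2 / Thm. 6.3 (`Squarefree`, `SatisfiesHeegnerHypothesis
  (N₁ * N₂) K`).
* Inherited: `CW24-local-condition`, `away-p`, `away-p-compact`, `HLV-vs-Kob-layers`, `Shapiro`, `lim-m`,
  `tot-ram-via-h_K` (module docstrings of the two parent files). In particular the `K_∞`-level group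
  `Sel^±_{p^∞}(E/K_∞)` of the facts is `Kobayashi2003.signedSelmerInfty (W⁄K) κ ε` and its dual data are
  `Kobayashi2003.SignedSelmerDualData (W⁄K) κ γ ε`, exactly as in the parent facts
  `hatleyLeiVigni2022_prop39_control_base` / `longoVigni2019_thm14_signedSelmerDual_rank_one`.

## NOT in this file (and why)

* Prop. 4.4/4.5 (`𝓗^±_∞` free of rank one — [LV-BUMI]'s theorem, `p ≥ 5` provenance), Lemma 4.7/4.8,
  §5.1 (admissible primes/sets, `H¹_{Σ,±}`, Lemma 5.4, **Thm. 5.5** `H¹_{Σ,±}(K_n, A_m) ≃ R_{m,n}^{2|Σ|}`),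
  Prop. 5.6 and Thm. 5.8 (the perfect pairings on Tate cohomology / with `Sel_{G_∞}`), Lemma 5.10/5.12:
  internal steps of the printed proof (pairings on the tree's `H¹` are not typed); recorded by locator.
* A. Matar, *Plus/minus Selmer groups and anticyclotomic `ℤ_p`-extensions*, Res. Number Theory 7
  (2021) no. 43 [Matar19 of the source]: text still unobtainable (acq-13695, acq-13961); B.-D. Kim,
  Canad. J. Math. 66 (2014) (doubly-signed Selmer groups over the `ℤ_p²`-extension): no consumer on the
  cell's deciding chain (director ruling W-10; offer C2 of the seat's notes).
* No conjecture is stated; no hypothesis structure carries data; the `Λ`-module structures used are the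
  parent files' `def`s (`letI`), never instances.
-/

noncomputable section

open scoped Classical

open NumberField IsDedekindDomain Field
open Literature.NumberTheory.EllipticCurves Literature.NumberTheory.GaloisRepresentations
open Literature.NumberTheory.EllipticCurves.GreenbergSelmer
open Literature.NumberTheory.EllipticCurves.Kobayashi2003
open WeierstrassCurve (geomTorsion geomPoints)

universe u

namespace Literature.NumberTheory.EllipticCurves.AcSigned

/-! ## Part 1. `E(K_n)`, the traces `Tr_{n/m}` and the plus/minus Mordell–Weil groups `E^±(K_n)` -/

section GlobalLayers

variable {K : Type u} [Field K] {p : ℕ} [Fact p.Prime] (κ : ZpExtension K p) (W : WeierstrassCurve K)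

/-- The relative quotient `Gal(K̄/K_m)/Gal(K̄/K_n)` (a copy of `𝒢_{n/m} = Gal(K_n/K_m)` for `m ≤ n`,
Hatley–Lei–Vigni §2.1: "`𝒢_{n'/n} := Gal(K_{n'}/K_n)`", a quotient of `G_{n'} ≃ ℤ/p^{n'}ℤ`) is finite.
(`[Γ_K : Gal(K̄/K_n)] = pⁿ`, `ZpExtension.index_layerSubgroup`; the `FiniteIndex` instance is the tree's
`ZpExtension.finiteIndex_layerSubgroup` of `BSDSelmerParityDokchitserTowerProofs`, re-derived inline to keep
the imports of this file minimal.) [cite: HatleyLeiVigni2022, §2.1 (𝒢_{n'/n})] -/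
theorem finite_layerQuotient (m n : ℕ) :
    Finite (κ.layerSubgroup m ⧸ (κ.layerSubgroup n).subgroupOf (κ.layerSubgroup m)) := by
  haveI : (κ.layerSubgroup n).FiniteIndex :=
    ⟨by rw [κ.index_layerSubgroup n]; exact pow_ne_zero _ (Fact.out : p.Prime).ne_zero⟩
  infer_instance

/-- **`E(K_n) = E(K̄)^{Gal(K̄/K_n)}`**, the points of `W` over `K̄` fixed by the layer subgroup
`κ⁻¹(pⁿℤ_p)` — the Mordell–Weil group of the `n`-th layer seen inside `E(K̄)` (Galois descent over a
perfect field, `WeierstrassCurve.fixedPoints_eq_range_map`), the global twin of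
`Kobayashi2003.localLayerPointsOfEmb`. Hatley–Lei–Vigni §2.1/§4.1 (`E(K_n)`, `K_0 = K`). [cite: HatleyLeiVigni2022, §2.1 and Def. 4.1] -/
def mwLayer (n : ℕ) : AddSubgroup W.geomPoints :=
  FixedPoints.addSubgroup (κ.layerSubgroup n) W.geomPoints

/-- Membership in `E(K_n)`: fixed by every `σ ∈ Gal(K̄/K_n)`. [cite: HatleyLeiVigni2022, Def. 4.1] -/
theorem mem_mwLayer_iff (n : ℕ) (P : W.geomPoints) :
    P ∈ mwLayer κ W n ↔ ∀ σ : absoluteGaloisGroup K, σ ∈ κ.layerSubgroup n → σ • P = P := by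
  rw [mwLayer, FixedPoints.mem_addSubgroup, Subtype.forall]
  rfl

/-- The tower `E(K_m) ≤ E(K_n)` for `m ≤ n`. [cite: HatleyLeiVigni2022, §2.1] -/
theorem mwLayer_mono : Monotone (mwLayer κ W) := by
  intro m n h P hP
  rw [mem_mwLayer_iff] at hP ⊢
  exact fun σ hσ ↦ hP σ (κ.layerSubgroup_antitone h hσ)

/-- `E(K_0) = E(K̄)^{Γ_K}` (`κ.layerSubgroup 0 = ⊤`). [cite: HatleyLeiVigni2022, §2.1 (K_0 = K)] -/
theorem mem_mwLayer_zero_iff (P : W.geomPoints) :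
    P ∈ mwLayer κ W 0 ↔ ∀ σ : absoluteGaloisGroup K, σ • P = P := by
  simp [mem_mwLayer_iff, ZpExtension.layerSubgroup_zero]

/-- **The trace `Tr_{n/m}`** as an endomorphism of `E(K̄)`: `P ↦ ∑_q q̃ • P`, the sum over the
(finite) quotient `Gal(K̄/K_m)/Gal(K̄/K_n)` of chosen representatives `q̃ = q.out`. On `P ∈ E(K_n)` and
for `m ≤ n` this is the Galois trace `Tr_{n/m} P = ∑_{σ ∈ Gal(K_n/K_m)} σP ∈ E(K_m)` of the source
("`Tr_{n/m+1} : E(K_n) → E(K_{m+1})` be the Galois trace map with respect to the group law on `E`",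
§4.1), independent of the representatives (`mwTrace_apply_eq_sum_of_mem`); elsewhere a documented junk
value. The global twin of `Kobayashi2003.localTraceOfEmb`. [cite: HatleyLeiVigni2022, §4.1 (before Def. 4.1)] -/
def mwTrace (m n : ℕ) : W.geomPoints →+ W.geomPoints :=
  haveI := finite_layerQuotient κ m n
  haveI := Fintype.ofFinite (κ.layerSubgroup m ⧸ (κ.layerSubgroup n).subgroupOf (κ.layerSubgroup m))
  ∑ q : κ.layerSubgroup m ⧸ (κ.layerSubgroup n).subgroupOf (κ.layerSubgroup m),
    DistribSMul.toAddMonoidHom W.geomPoints ((q.out : κ.layerSubgroup m) : absoluteGaloisGroup K)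

/-- Unfolding the trace: `Tr_{n/m} P = ∑_q q.out • P` (any `Fintype` instance on the quotient).
[cite: HatleyLeiVigni2022, §4.1 (before Def. 4.1)] -/
theorem mwTrace_apply (m n : ℕ)
    [Fintype (κ.layerSubgroup m ⧸ (κ.layerSubgroup n).subgroupOf (κ.layerSubgroup m))]
    (P : W.geomPoints) :
    mwTrace κ W m n P =
      ∑ q : κ.layerSubgroup m ⧸ (κ.layerSubgroup n).subgroupOf (κ.layerSubgroup m),
        ((q.out : κ.layerSubgroup m) : absoluteGaloisGroup K) • P := by
  rw [mwTrace, AddMonoidHom.finsetSum_apply]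
  exact Finset.sum_congr (by convert rfl) fun q _ ↦ rfl

/-- For `P ∈ E(K_n)` the summand `q.out • P` only depends on the coset `q`: any representative `σ` of
`q` gives `σ • P`. [cite: HatleyLeiVigni2022, §4.1 (before Def. 4.1)] -/
theorem out_smul_eq_of_mem {m n : ℕ} {P : W.geomPoints} (hP : P ∈ mwLayer κ W n)
    (σ : κ.layerSubgroup m) :
    ((QuotientGroup.mk (s := (κ.layerSubgroup n).subgroupOf (κ.layerSubgroup m)) σ).out :
        absoluteGaloisGroup K) • P = (σ : absoluteGaloisGroup K) • P := by
  obtain ⟨h, hh⟩ := QuotientGroup.mk_out_eq_mul ((κ.layerSubgroup n).subgroupOf (κ.layerSubgroup m)) σ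
  rw [hh, Subgroup.coe_mul, mul_smul]
  congr 1
  exact (mem_mwLayer_iff κ W n P).mp hP _ (Subgroup.mem_subgroupOf.mp h.2)

/-- **Independence of representatives.** For `P ∈ E(K_n)` and ANY section `s` of
`Gal(K̄/K_m) → Gal(K̄/K_m)/Gal(K̄/K_n)`, `Tr_{n/m} P = ∑_q s(q) • P` — so `mwTrace` IS the Galois trace
of the source on `E(K_n)`. [cite: HatleyLeiVigni2022, §4.1 (before Def. 4.1)] -/
theorem mwTrace_apply_eq_sum_of_mem (m n : ℕ)
    [Fintype (κ.layerSubgroup m ⧸ (κ.layerSubgroup n).subgroupOf (κ.layerSubgroup m))]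
    {P : W.geomPoints} (hP : P ∈ mwLayer κ W n)
    (s : κ.layerSubgroup m ⧸ (κ.layerSubgroup n).subgroupOf (κ.layerSubgroup m) → κ.layerSubgroup m)
    (hs : ∀ q, (QuotientGroup.mk (s q) : _ ⧸ _) = q) :
    mwTrace κ W m n P = ∑ q, ((s q : κ.layerSubgroup m) : absoluteGaloisGroup K) • P := by
  rw [mwTrace_apply]
  refine Finset.sum_congr rfl fun q _ ↦ ?_
  conv_lhs => rw [← hs q]
  exact out_smul_eq_of_mem κ W hP (s q)

/-- `Tr_{n/m} P ∈ E(K_m)` for `P ∈ E(K_n)`: left multiplication by `τ ∈ Gal(K̄/K_m)` permutes the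
cosets. [cite: HatleyLeiVigni2022, §4.1 (before Def. 4.1)] -/
theorem mwTrace_mem_of_mem (m n : ℕ) {P : W.geomPoints} (hP : P ∈ mwLayer κ W n) :
    mwTrace κ W m n P ∈ mwLayer κ W m := by
  classical
  set N := (κ.layerSubgroup n).subgroupOf (κ.layerSubgroup m) with hN
  haveI := finite_layerQuotient κ m n
  haveI : Fintype (κ.layerSubgroup m ⧸ N) := Fintype.ofFinite _
  rw [mem_mwLayer_iff]
  intro τ hτ
  rw [mwTrace_apply, Finset.smul_sum]
  have key : ∀ q : κ.layerSubgroup m ⧸ N,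
      τ • (((q.out : κ.layerSubgroup m) : absoluteGaloisGroup K) • P) =
        ((((⟨τ, hτ⟩ : κ.layerSubgroup m) • q).out : κ.layerSubgroup m) : absoluteGaloisGroup K) • P := by
    intro q
    have h1 : (⟨τ, hτ⟩ : κ.layerSubgroup m) • q = QuotientGroup.mk (s := N) (⟨τ, hτ⟩ * q.out) := by
      conv_lhs => rw [← QuotientGroup.out_eq' q]
      rfl
    rw [h1, out_smul_eq_of_mem κ W hP, Subgroup.coe_mul, mul_smul]
  simp_rw [key]
  exact Fintype.sum_equiv (MulAction.toPerm (⟨τ, hτ⟩ : κ.layerSubgroup m)) _ _ fun q ↦ rfl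

/-- **Hatley–Lei–Vigni's plus/minus Mordell–Weil groups `E^ε(K_n)`** (`ε = 1`: `E^+`, `S^+_n` = even
indices; `ε = -1`: `E^-`, `S^-_n` = odd indices), Def. 4.1 verbatim: `E^±(K_n) := {P ∈ E(K_n) |
Tr_{n/m+1}(P) ∈ E(K_m) for all m ∈ S^±_n with m < n}`, `S_n^+ := {0, …, n} ∩ 2ℤ`, `S_n^- := {0, …, n} ∩
(2ℤ+1)` — i.e. the points `P ∈ E(K_n)` with `Tr_{n/m+1} P ∈ E(K_m)` for every `m < n` with
`(-1)^m = ε` ("global counterparts of the plus/minus norm groups" of §3.1). An additive subgroup; for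
`n = 0` it is `E(K)`. Same shape as `Kobayashi2003.signedLocalPointsOfEmb` (local, Kobayashi Def. 1.1).
[cite: HatleyLeiVigni2022, Def. 4.1 and §3.1 (S_n^±)] -/
def signedMWLayer (ε : ℤˣ) (n : ℕ) : AddSubgroup W.geomPoints where
  carrier := {P | P ∈ mwLayer κ W n ∧ ∀ m < n, (m : ℤ).negOnePow = ε →
    mwTrace κ W (m + 1) n P ∈ mwLayer κ W m}
  zero_mem' := ⟨zero_mem _, fun m _ _ ↦ by rw [map_zero]; exact zero_mem _⟩
  add_mem' := fun {P Q} hP hQ ↦ ⟨add_mem hP.1 hQ.1, fun m hm hε ↦ by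
    rw [map_add]; exact add_mem (hP.2 m hm hε) (hQ.2 m hm hε)⟩
  neg_mem' := fun {P} hP ↦ ⟨neg_mem hP.1, fun m hm hε ↦ by
    rw [map_neg]; exact neg_mem (hP.2 m hm hε)⟩

/-- Membership in `E^ε(K_n)` (Def. 4.1 unfolded). [cite: HatleyLeiVigni2022, Def. 4.1] -/
theorem mem_signedMWLayer_iff (ε : ℤˣ) (n : ℕ) (P : W.geomPoints) :
    P ∈ signedMWLayer κ W ε n ↔ P ∈ mwLayer κ W n ∧ ∀ m < n, (m : ℤ).negOnePow = ε →
      mwTrace κ W (m + 1) n P ∈ mwLayer κ W m :=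
  Iff.rfl

/-- `E^ε(K_n) ≤ E(K_n)`. [cite: HatleyLeiVigni2022, Def. 4.1] -/
theorem signedMWLayer_le (ε : ℤˣ) (n : ℕ) : signedMWLayer κ W ε n ≤ mwLayer κ W n :=
  fun _ hP ↦ hP.1

/-- `E^ε(K_0) = E(K)`: at the base there is no trace condition. [cite: HatleyLeiVigni2022, Def. 4.1 and Lemma 5.13 (ℋ^±_0[p^m] = E(K)/p^m)] -/
theorem signedMWLayer_zero (ε : ℤˣ) : signedMWLayer κ W ε 0 = mwLayer κ W 0 := by
  ext P
  rw [mem_signedMWLayer_iff]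
  exact ⟨fun h ↦ h.1, fun h ↦ ⟨h, fun m hm ↦ absurd hm (Nat.not_lt_zero m)⟩⟩

/-- The "even `m`" form of `E^+(K_n)` (`S_n^+ = {0, …, n} ∩ 2ℤ`). [cite: HatleyLeiVigni2022, Def. 4.1 and §3.1] -/
theorem mem_signedMWLayer_one_iff (n : ℕ) (P : W.geomPoints) :
    P ∈ signedMWLayer κ W 1 n ↔ P ∈ mwLayer κ W n ∧ ∀ m < n, Even m →
      mwTrace κ W (m + 1) n P ∈ mwLayer κ W m := by
  simp only [mem_signedMWLayer_iff, Int.negOnePow_eq_one_iff, Int.even_coe_nat]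

/-- The "odd `m`" form of `E^-(K_n)` (`S_n^- = {0, …, n} ∩ (2ℤ+1)`). [cite: HatleyLeiVigni2022, Def. 4.1 and §3.1] -/
theorem mem_signedMWLayer_neg_one_iff (n : ℕ) (P : W.geomPoints) :
    P ∈ signedMWLayer κ W (-1) n ↔ P ∈ mwLayer κ W n ∧ ∀ m < n, Odd m →
      mwTrace κ W (m + 1) n P ∈ mwLayer κ W m := by
  simp only [mem_signedMWLayer_iff, Int.negOnePow_eq_neg_one_iff, Int.odd_coe_nat]

end GlobalLayers

/-! ## Part 2. The Kummer images `ℋ^±_∞`, `ℋ^±_n[p^m]`, and the plus/minus (relative)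
Shafarevich–Tate groups -/

section KummerImages

variable {K : Type u} [Field K] (W : WeierstrassCurve K) (p : ℕ) [Fact p.Prime] (κ : ZpExtension K p)

/-- **`ℋ^ε_∞ := ⋃_{k ≥ 0} E^ε(K_k) ⊗ ℚ_p/ℤ_p ⊂ H¹(K_∞, E[p^∞])`** (§4.1, "via the usual Kummer map in
Galois cohomology", Remark 4.2): the additive subgroup of `H¹(K_∞, E[p^∞])` generated by the classes
`θ_{k,m}(δ_{K_k}(P))` for `P ∈ E^ε(K_k)` — `δ_{K_k}(P) = [σ ↦ σQ − Q] ∈ H¹(K_k, E[p^m])` the Kummer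
class of `P = p^m Q` (the tree's `WeierstrassCurve.kummerClassOver`, the Kummer image of the elementary
tensor `P ⊗ p^{-m}`; every element of `E^ε(K_k) ⊗ ℚ_p/ℤ_p` is a sum of such) and
`θ_{k,m} : H¹(K_k, E[p^m]) → H¹(K_∞, E[p^∞])` the map of Remark 3.1 (`AcSigned.toInfty`).
[cite: HatleyLeiVigni2022, §4.1 (ℋ^±_∞) and Remark 4.2] -/
def signedMWKummerInfty (ε : ℤˣ) : AddSubgroup (W.subgroupH1 p κ.kerSubgroup) :=
  AddSubgroup.closure (⋃ (k : ℕ) (m : ℕ), toInfty W p κ k m ''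
    {c | ∃ (Q : W.geomPoints)
        (hQ : ∀ σ ∈ κ.layerSubgroup k, σ • (((p : ℤ) ^ m) • Q) = ((p : ℤ) ^ m) • Q),
        ((p : ℤ) ^ m) • Q ∈ signedMWLayer κ W ε k ∧
          c = W.kummerClassOver (κ.layerSubgroup k) ((p : ℤ) ^ m) Q hQ})

/-- The Kummer class of a point of `E^ε(K_k)`, pushed to `H¹(K_∞, E[p^∞])`, lies in `ℋ^ε_∞` (a
generator). [cite: HatleyLeiVigni2022, §4.1 (ℋ^±_∞) and Remark 4.2] -/
theorem toInfty_kummerClassOver_mem_signedMWKummerInfty (ε : ℤˣ) (k m : ℕ) (Q : W.geomPoints)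
    (hQ : ∀ σ ∈ κ.layerSubgroup k, σ • (((p : ℤ) ^ m) • Q) = ((p : ℤ) ^ m) • Q)
    (hmem : ((p : ℤ) ^ m) • Q ∈ signedMWLayer κ W ε k) :
    toInfty W p κ k m (W.kummerClassOver (κ.layerSubgroup k) ((p : ℤ) ^ m) Q hQ) ∈
      signedMWKummerInfty W p κ ε := by
  refine AddSubgroup.subset_closure (Set.mem_iUnion.mpr ⟨k, Set.mem_iUnion.mpr ⟨m, ?_⟩⟩)
  exact ⟨_, ⟨Q, hQ, hmem, rfl⟩, rfl⟩

/-- **`ℋ^ε_n[p^m] ⊂ H¹(K_n, E[p^m])`** (`ℋ^ε_n := (ℋ^ε_∞)^{Gal(K_∞/K_n)}`, §4.1; "we may view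
`ℋ^±_n[p^m]` as a `Λ`-submodule of `Sel^±_{p^m}(E/K_n)`", Remark 4.2): the classes of `H¹(K_n, E[p^m])`
whose image under `θ_{n,m}` lies in `ℋ^ε_∞` — the PULLBACK (flag `HLV-pullback`: under
`H¹(K_n, A_m) ≃ H¹(K_∞, A)^{𝒢_{∞/n}}[p^m]`, Remark 3.1/4.2, this is the printed group).
[cite: HatleyLeiVigni2022, §4.1 (ℋ^±_n) and Remark 4.2] -/
def signedMWKummerLayer (ε : ℤˣ) (n m : ℕ) :
    AddSubgroup (W.torsionH1Over ((p : ℤ) ^ m) (κ.layerSubgroup n)) :=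
  (signedMWKummerInfty W p κ ε).comap (toInfty W p κ n m)

variable {W p κ}

/-- Membership in `ℋ^ε_n[p^m]` (unfolding). [cite: HatleyLeiVigni2022, §4.1 and Remark 4.2] -/
theorem mem_signedMWKummerLayer_iff {ε : ℤˣ} {n m : ℕ}
    (c : W.torsionH1Over ((p : ℤ) ^ m) (κ.layerSubgroup n)) :
    c ∈ signedMWKummerLayer W p κ ε n m ↔ toInfty W p κ n m c ∈ signedMWKummerInfty W p κ ε :=
  Iff.rfl

/-- The Kummer classes of the points of `E^ε(K_n)` lie in `ℋ^ε_n[p^m]` ("`E^±(K_n)/p^m ⊂ ℋ^±_n[p^m]`",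
the inclusion behind Lemma 5.13's `ℋ^±_0[p^m] = E(K)/p^m E(K)`).
[cite: HatleyLeiVigni2022, Remark 4.2 and Lemma 5.13] -/
theorem kummerClassOver_mem_signedMWKummerLayer {ε : ℤˣ} {n m : ℕ} (Q : W.geomPoints)
    (hQ : ∀ σ ∈ κ.layerSubgroup n, σ • (((p : ℤ) ^ m) • Q) = ((p : ℤ) ^ m) • Q)
    (hmem : ((p : ℤ) ^ m) • Q ∈ signedMWLayer κ W ε n) :
    W.kummerClassOver (κ.layerSubgroup n) ((p : ℤ) ^ m) Q hQ ∈ signedMWKummerLayer W p κ ε n m :=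
  toInfty_kummerClassOver_mem_signedMWKummerInfty W p κ ε n m Q hQ hmem

/-- Restriction `K_n → K_{n+1}` carries `ℋ^ε_n[p^m]` into `ℋ^ε_{n+1}[p^m]` (`θ_{n+1,m} ∘ res = θ_{n,m}`,
`AcSigned.toInfty_resOfLe`) — the map "induced by restriction" of Def. 5.11 on the `ℋ`-parts, and the
inclusion `𝔈^±_{m,n} ↪ 𝔈^±_{m,n+1}` of Lemma 4.8 for the analogous pullbacks.
[cite: HatleyLeiVigni2022, Def. 5.11 and Lemma 4.8] -/
theorem resOfLe_mem_signedMWKummerLayer {ε : ℤˣ} {n n' : ℕ} (h : n ≤ n') {m : ℕ}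
    {c : W.torsionH1Over ((p : ℤ) ^ m) (κ.layerSubgroup n)} (hc : c ∈ signedMWKummerLayer W p κ ε n m) :
    resOfLe (geomTorsion W ((p : ℤ) ^ m)) (κ.layerSubgroup_antitone h) c ∈
      signedMWKummerLayer W p κ ε n' m := by
  rw [mem_signedMWKummerLayer_iff, toInfty_resOfLe W p κ h]
  exact hc

variable (W p κ) [NumberField K]

/-- **The plus/minus `p^m`-Shafarevich–Tate group `Ш^ε_{p^m}(E/K_n) := Sel^ε_{p^m}(E/K_n)/ℋ^ε_n[p^m]`**
(Def. 5.11), as the quotient of `Sel^ε_{p^m}(E/K_n) = AcSigned.selmerTorsion … (sgn ε) n m`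
(Hatley–Lei–Vigni Def. 3.4) by `ℋ^ε_n[p^m] ∩ Sel^ε_{p^m}(E/K_n)` (`AddSubgroup.addSubgroupOf`; flag
`HLV-Rem-4.2`: the intersection IS `ℋ^ε_n[p^m]` by Remark 4.2). At `n = 0` this is the classical
`Ш_{p^m}(E/K) = Sel_{p^m}(E/K)/(E(K)/p^m)` (Lemma 3.7 + Lemma 5.13). A type (an additive commutative
group). [cite: HatleyLeiVigni2022, Def. 5.11] -/
abbrev signedSha (ε : ℤˣ) (n m : ℕ) : Type u :=
  ↥(selmerTorsion W p κ (fun _ ↦ .sgn ε) n m) ⧸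
    (signedMWKummerLayer W p κ ε n m).addSubgroupOf (selmerTorsion W p κ (fun _ ↦ .sgn ε) n m)

/-- **"`Ш^ε_{p^m}(E, K_{n+1}/K_n) = 0`"** — the vanishing of the RELATIVE plus/minus Shafarevich–Tate
group `ker(Ш^ε_{p^m}(E/K_n) → Ш^ε_{p^m}(E/K_{n+1}))` (Def. 5.11, "the map on the right is induced by
restriction"), UNFOLDED: a class `c ∈ Sel^ε_{p^m}(E/K_n)` whose restriction to `K_{n+1}` lies in
`ℋ^ε_{n+1}[p^m]` (i.e. whose image in `Ш^ε_{p^m}(E/K_{n+1})` vanishes) already lies in `ℋ^ε_n[p^m]`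
(i.e. vanishes in `Ш^ε_{p^m}(E/K_n)`). The map is well defined on the `ℋ`-parts by
`resOfLe_mem_signedMWKummerLayer`. This is the first clause of hypothesis (mod `p`) (with `m = 1`) and
the hypothesis of Lemma 5.12. [cite: HatleyLeiVigni2022, Def. 5.11 and §1.2 (mod p)] -/
def RelSignedShaVanishes (ε : ℤˣ) (n m : ℕ) : Prop :=
  ∀ c ∈ selmerTorsion W p κ (fun _ ↦ .sgn ε) n m,
    resOfLe (geomTorsion W ((p : ℤ) ^ m)) (κ.layerSubgroup_antitone (Nat.le_succ n)) c ∈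
        signedMWKummerLayer W p κ ε (n + 1) m →
      c ∈ signedMWKummerLayer W p κ ε n m

end KummerImages

/-! ## Part 3. Plus/minus Heegner points `z^±_n`, the modules `𝓔^±_{m,n}`, `𝓔^±_∞` and `𝔈^±_{m,n}` -/

section HeegnerPart

variable {K : Type u} [Field K] [NumberField K] {N : ℕ} [NeZero N] (W : WeierstrassCurve ℚ)
  (p : ℕ) [Fact p.Prime] (κ : ZpExtension K p) {jbar : AlgebraicClosure K →+* ℂ}
  (F : HeegnerFamily N W K κ jbar)

/-- **The plus/minus Heegner points `z^ε_n`** (Def. 4.3) of a compatible family `{z_n ∈ E(K_n)}` of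
Heegner points along the anticyclotomic tower ("as in [LV-BUMI]" = the tree's `HeegnerFamily`,
`F.z n = Norm_{K[p^{n+1}]/K_n} P[p^{n+1}]`; flag `HLV-LV-family`): `z^+_n := z_n` (`n` even), `z_{n−1}`
(`n` odd); `z^-_n := z_{n−1}` (`n` even), `z_n` (`n` odd) — i.e. `z^ε_n = z_n` if `(-1)^n = ε` and
`z_{n−1}` otherwise; at `(ε, n) = (−1, 0)` the value is `z_0` (`ℕ`-subtraction), which is the source's
displayed convention "`((p−1)/2) z^-_0 = ((p−1)/2) z_0`". Since `a_p = 0` the points satisfy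
`z^±_m ∈ E^±(K_m)` and the trace relations of §4.2 ([Perrin-Riou]) — consequences in print, not
re-derived here. [cite: HatleyLeiVigni2022, Def. 4.3] -/
def signedHeegnerPoint (ε : ℤˣ) (n : ℕ) : (W.baseChange K).geomPoints :=
  if (n : ℤ).negOnePow = ε then F.z n else F.z (n - 1)

/-- `z^ε_n` is `K_n`-rational: fixed by `Gal(K̄/K_n)` (it is `z_n` or `z_{n−1}`, both rational over
`K_n`; `HeegnerFamily.smul_eq_of_mem_generators`). [cite: HatleyLeiVigni2022, Def. 4.3 (z_n ∈ E(K_n))] -/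
theorem smul_signedHeegnerPoint_of_mem (ε : ℤˣ) (n : ℕ) {σ : absoluteGaloisGroup K}
    (hσ : σ ∈ κ.layerSubgroup n) : σ • signedHeegnerPoint W p κ F ε n = signedHeegnerPoint W p κ F ε n := by
  unfold signedHeegnerPoint
  split_ifs
  · exact F.smul_eq_of_mem_generators (Or.inr ⟨n, Set.mem_setOf.mpr le_rfl, rfl⟩) hσ
  · exact F.smul_eq_of_mem_generators (Or.inr ⟨n - 1, Set.mem_setOf.mpr (Nat.sub_le n 1), rfl⟩) hσ

/-- `z^ε_n ∈ E(K_n)` (`mwLayer`). [cite: HatleyLeiVigni2022, Def. 4.3 (z_n ∈ E(K_n))] -/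
theorem signedHeegnerPoint_mem_mwLayer (ε : ℤˣ) (n : ℕ) :
    signedHeegnerPoint W p κ F ε n ∈ mwLayer κ (W.baseChange K) n :=
  (mem_mwLayer_iff κ (W.baseChange K) n _).mpr fun _ hσ ↦ smul_signedHeegnerPoint_of_mem W p κ F ε n hσ

/-- A `p^m`-th root `Q` of `z^ε_n` satisfies the hypothesis of `kummerClassOver` over `K_n`
(`p^m Q = z^ε_n` is fixed by `Gal(K̄/K_n)`). [cite: HatleyLeiVigni2022, §4.2 (𝓔^±_{m,n})] -/
theorem smul_zsmul_eq_of_root (ε : ℤˣ) (n m : ℕ) {Q : (W.baseChange K).geomPoints}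
    (hQ : ((p : ℤ) ^ m) • Q = signedHeegnerPoint W p κ F ε n) :
    ∀ σ ∈ κ.layerSubgroup n, σ • (((p : ℤ) ^ m) • Q) = ((p : ℤ) ^ m) • Q := fun σ hσ ↦ by
  rw [hQ]; exact smul_signedHeegnerPoint_of_mem W p κ F ε n hσ

/-- **`𝓔^ε_{m,n} ⊂ H¹(K_n, E[p^m])`**: "the `R_{m,n}`-submodule of `Sel^±_{p^m}(E/K_n)` generated by
`z^±_n`", `R_{m,n} = (ℤ/p^mℤ)[G_n]` (§4.2, as in [LV-BUMI]) — the additive subgroup generated by the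
`G_n`-translates `conj_σ δ_{K_n}(z^ε_n)`, `σ ∈ Γ_K` (acting through `G_n = Γ_K/Gal(K̄/K_n)`), of the
Kummer class `δ_{K_n}(z^ε_n) ∈ H¹(K_n, E[p^m])` (`kummerClassOver` at any `p^m`-th root `Q` of `z^ε_n`;
roots exist in characteristic `0` and the class does not depend on the root). Its being inside
`Sel^ε_{p^m}(E/K_n)` (§4.2, Lemma 4.7) is the source's, not re-proved (flag `HLV-Rem-4.2`).
[cite: HatleyLeiVigni2022, §4.2 (𝓔^±_{m,n}, R_{m,n})] -/
def signedHeegnerModuleLayer (ε : ℤˣ) (n m : ℕ) :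
    AddSubgroup ((W.baseChange K).torsionH1Over ((p : ℤ) ^ m) (κ.layerSubgroup n)) :=
  AddSubgroup.closure {c | ∃ (σ : absoluteGaloisGroup K) (Q : (W.baseChange K).geomPoints)
    (hQ : ((p : ℤ) ^ m) • Q = signedHeegnerPoint W p κ F ε n),
    c = conjH1 (κ.layerSubgroup n) (geomTorsion (W.baseChange K) ((p : ℤ) ^ m)) σ
      ((W.baseChange K).kummerClassOver (κ.layerSubgroup n) ((p : ℤ) ^ m) Q
        (smul_zsmul_eq_of_root W p κ F ε n m hQ))}

/-- **`𝓔^ε_∞ := lim→_m 𝓔^ε_{m,m} ⊂ Sel^ε_{p^∞}(E/K_∞) ⊂ H¹(K_∞, E[p^∞])`** (§4.2): the union over `m` of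
the images of `𝓔^ε_{m,m}` under `θ_{m,m} : H¹(K_m, E[p^m]) → H¹(K_∞, E[p^∞])`. Its Pontryagin dual is
`𝓗^ε_∞` (Prop. 4.4/4.5: free of rank one over `Λ`, [LV-BUMI] — not asserted).
[cite: HatleyLeiVigni2022, §4.2 (𝓔^±_∞, 𝓗^±_∞)] -/
def signedHeegnerModuleInfty (ε : ℤˣ) : AddSubgroup ((W.baseChange K).subgroupH1 p κ.kerSubgroup) :=
  ⨆ m : ℕ, (signedHeegnerModuleLayer W p κ F ε m m).map (toInfty (W.baseChange K) p κ m m)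

/-- `θ_{m,m}(𝓔^ε_{m,m}) ≤ 𝓔^ε_∞`. [cite: HatleyLeiVigni2022, §4.2 (𝓔^±_∞)] -/
theorem map_toInfty_signedHeegnerModuleLayer_le (ε : ℤˣ) (m : ℕ) :
    (signedHeegnerModuleLayer W p κ F ε m m).map (toInfty (W.baseChange K) p κ m m) ≤
      signedHeegnerModuleInfty W p κ F ε :=
  le_iSup (fun m ↦ (signedHeegnerModuleLayer W p κ F ε m m).map (toInfty (W.baseChange K) p κ m m)) m

/-- **`𝔈^ε_{m,n} := (𝓔^ε_∞)^{Gal(K_∞/K_n)}[p^m]`** (§4.2), "an `R_{m,n}`-module", viewed in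
`H¹(K_n, E[p^m])` (Lemma 4.7: `𝔈^±_{m,n} ↪ Sel^±_{p^m}(E/K_n)`; Lemma 4.8: `𝔈^±_{m,n} ≃
(𝔈^±_{m,n+1})^{𝒢_{n+1/n}}` via inflation–restriction): the PULLBACK of `𝓔^ε_∞` along `θ_{n,m}` (flag
`HLV-pullback`). `𝔈^ε_n := 𝔈^ε_{1,n}` is the module of hypothesis (mod `p`) ("`𝔈^±_n ≠ 0`";
Remark 5.14: "has been established in some cases … [Burungale]"), cyclic over `R_n` (Cor. 4.6).
[cite: HatleyLeiVigni2022, §4.2 (𝔈^±_{m,n}), Lemma 4.7, Lemma 4.8] -/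
def frakE (ε : ℤˣ) (n m : ℕ) :
    AddSubgroup ((W.baseChange K).torsionH1Over ((p : ℤ) ^ m) (κ.layerSubgroup n)) :=
  (signedHeegnerModuleInfty W p κ F ε).comap (toInfty (W.baseChange K) p κ n m)

variable {W p κ F}

/-- Membership in `𝔈^ε_{m,n}` (unfolding). [cite: HatleyLeiVigni2022, §4.2 (𝔈^±_{m,n})] -/
theorem mem_frakE_iff {ε : ℤˣ} {n m : ℕ}
    (c : (W.baseChange K).torsionH1Over ((p : ℤ) ^ m) (κ.layerSubgroup n)) :
    c ∈ frakE W p κ F ε n m ↔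
      toInfty (W.baseChange K) p κ n m c ∈ signedHeegnerModuleInfty W p κ F ε :=
  Iff.rfl

/-- `𝓔^ε_{m,m} ≤ 𝔈^ε_{m,m}` (the generators at level `m` are `Gal(K_∞/K_m)`-invariant `p^m`-torsion
elements of `𝓔^ε_∞`). [cite: HatleyLeiVigni2022, §4.2 and Lemma 4.7] -/
theorem signedHeegnerModuleLayer_le_frakE (ε : ℤˣ) (m : ℕ) :
    signedHeegnerModuleLayer W p κ F ε m m ≤ frakE W p κ F ε m m := fun c hc ↦
  map_toInfty_signedHeegnerModuleLayer_le W p κ F ε m ⟨c, hc, rfl⟩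

/-- `𝔈^ε_{m,n} ↪ 𝔈^ε_{m,n+1}` along restriction (the injection of Lemma 4.8, as an inclusion of
pullbacks). [cite: HatleyLeiVigni2022, Lemma 4.8] -/
theorem resOfLe_mem_frakE {ε : ℤˣ} {n n' : ℕ} (h : n ≤ n') {m : ℕ}
    {c : (W.baseChange K).torsionH1Over ((p : ℤ) ^ m) (κ.layerSubgroup n)} (hc : c ∈ frakE W p κ F ε n m) :
    resOfLe (geomTorsion (W.baseChange K) ((p : ℤ) ^ m)) (κ.layerSubgroup_antitone h) c ∈
      frakE W p κ F ε n' m := by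
  rw [mem_frakE_iff, toInfty_resOfLe (W.baseChange K) p κ h]
  exact hc

end HeegnerPart

/-! ## Part 4. Universal norms `US^±_p(E/K) ⊂ S^±_p(E/K)`, the finite-index predicates, and the
reflexive defect `T₂(M)` -/

section UniversalNorms

variable {K : Type u} [Field K] [NumberField K] (W : WeierstrassCurve K) (p : ℕ) [Fact p.Prime]
  (κ : ZpExtension K p) (γ : absoluteGaloisGroup K)

/-- **The universal norms `US^ε_p(E/K) := ⋂_{n ≥ 1} cor_{K_n/K}(S^ε_p(E/K_n)) ⊂ S^ε_p(E/K)`** (§5.2),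
transcribed (flag `US-as-limit`) as the level-`0` components `x_0 ∈ S^ε_p(E/K) = lim←_m Sel^ε_{p^m}(E/K)`
of the norm-compatible families `x = (x_n)_n ∈ Ŝ^ε_p(E/K_∞) = lim←_n S^ε_p(E/K_n)`
(`AcSigned.selmerLambdaAdic … (sgn ε)`, the compact `Λ`-adic signed Selmer module). An additive
subgroup of `∏_m H¹(K, E[p^m])`; `ℤ_p` acts through `WeierstrassCurve.padicPi`.
[cite: HatleyLeiVigni2022, §5.2 (US^±_p(E/K), Ŝ^±_p(E/K_∞))] -/
def universalNorms (ε : ℤˣ) : AddSubgroup (Π m : ℕ, W.torsionH1Over ((p : ℤ) ^ m) (κ.layerSubgroup 0)) :=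
  (selmerLambdaAdic W p κ γ (fun _ ↦ .sgn ε)).map
    (Pi.evalAddMonoidHom (fun n : ℕ ↦ Π m : ℕ, W.torsionH1Over ((p : ℤ) ^ m) (κ.layerSubgroup n)) 0)

variable {W p κ γ}

/-- Membership in `US^ε_p(E/K)`: being the bottom of a norm-compatible family. [cite: HatleyLeiVigni2022, §5.2] -/
theorem mem_universalNorms_iff {ε : ℤˣ} (y : Π m : ℕ, W.torsionH1Over ((p : ℤ) ^ m) (κ.layerSubgroup 0)) :
    y ∈ universalNorms W p κ γ ε ↔ ∃ x ∈ selmerLambdaAdic W p κ γ (fun _ ↦ .sgn ε), x 0 = y := by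
  simp only [universalNorms, AddSubgroup.mem_map, Pi.evalAddMonoidHom_apply]

/-- `US^ε_p(E/K) ≤ S^ε_p(E/K) = Sel^ε(K_0, T)` (`compactSelmerLayer … 0`). [cite: HatleyLeiVigni2022, §5.2] -/
theorem universalNorms_le_compactSelmerLayer (ε : ℤˣ) :
    universalNorms W p κ γ ε ≤ compactSelmerLayer W p κ (fun _ ↦ .sgn ε) 0 := by
  intro y hy
  obtain ⟨x, hx, rfl⟩ := (mem_universalNorms_iff y).1 hy
  exact ((mem_selmerLambdaAdic_iff x).1 hx).1 0

variable (W p κ γ)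

/-- **"`US^ε_p(E/K)` is free of rank one over `ℤ_p`"** (the first conclusion of Thm. 5.15): there is
`u ∈ US^ε_p(E/K)` with trivial `ℤ_p`-annihilator such that `US^ε_p(E/K) = ℤ_p · u` (`ℤ_p` acting on
`∏_m H¹(K, E[p^m])` through `padicPi`). [cite: HatleyLeiVigni2022, Thm. 5.15] -/
def UniversalNormsFreeRankOne (ε : ℤˣ) : Prop :=
  ∃ u ∈ universalNorms W p κ γ ε,
    (∀ c : ℤ_[p], W.padicPi p (κ.layerSubgroup 0) c u = 0 → c = 0) ∧
    ∀ x ∈ universalNorms W p κ γ ε, ∃ c : ℤ_[p], x = W.padicPi p (κ.layerSubgroup 0) c u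

/-- **"`S^ε_p(E/K)/US^ε_p(E/K)` has no `ℤ_p`-torsion"** (the condition of Cor. 5.9): an element of
`S^ε_p(E/K)` a non-zero `ℤ_p`-multiple of which is a universal norm is itself a universal norm.
[cite: HatleyLeiVigni2022, Cor. 5.9] -/
def UniversalNormsSaturated (ε : ℤˣ) : Prop :=
  ∀ x ∈ compactSelmerLayer W p κ (fun _ ↦ .sgn ε) 0, ∀ c : ℤ_[p], c ≠ 0 →
    W.padicPi p (κ.layerSubgroup 0) c x ∈ universalNorms W p κ γ ε → x ∈ universalNorms W p κ γ ε

/-- **"`Sel^ε_{p^∞}(E/K_∞)` admits no proper `Λ`-submodule of finite index"** (Thm. 1.1 / Thm. 5.15 /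
Cor. 5.9), on the tree's `Kobayashi2003.signedSelmerInfty W κ ε` (= Hatley–Lei–Vigni's
`Sel^±_{p^∞}(E/K_∞)` by Remark 3.5, flag `away-p`): every `Γ_K`-stable additive subgroup
(`Λ = ℤ_p⟦G_∞⟧` acts through `conj_σ`; on a `p`-primary torsion group `ℤ_p`-submodules are the
additive subgroups) of finite index in `Sel^ε_∞` is all of it. Equivalently (§1: "or, equivalently, …
their Pontryagin duals have no nontrivial finite `Λ`-submodules") every finite `Λ`-submodule of a dual
datum `SignedSelmerDualData` is `⊥` — the form `AcSigned.X.NoFiniteSubmodule` of the sibling carriers.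
[cite: HatleyLeiVigni2022, Thm. 1.1 and §1 (p. 3, the equivalence)] -/
def NoProperFiniteIndexSubmodule (ε : ℤˣ) : Prop :=
  ∀ M : AddSubgroup (W.subgroupH1 p κ.kerSubgroup), M ≤ signedSelmerInfty W κ ε →
    (∀ (σ : absoluteGaloisGroup K), ∀ s ∈ M, W.conjH1 p κ.kerSubgroup σ s ∈ M) →
    (M.addSubgroupOf (signedSelmerInfty W κ ε)).FiniteIndex → M = signedSelmerInfty W κ ε

end UniversalNorms

section ReflexiveDefect

/-- **`T₂(M) := coker(M → M^{++})`**, the cokernel of the canonical map to the reflexive hull (bidual)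
`M^{++} = Hom_R(Hom_R(M, R), R)` (Mathlib `Module.Dual.eval`): the term of Jannsen's exact sequence
`0 → M_tor → M → M^{++} → T₂(M) → 0` through which Hatley–Lei–Vigni define `c(M)`,
`|T₂(M)[p]| = |𝔽_p|^{c(M)}` (Def. 6.1, after [Jan] and [MRL2]). Generic in the commutative ring `R`.
[cite: HatleyLeiVigni2022, §6.2 and Def. 6.1] -/
abbrev reflexiveDefect (R : Type*) (M : Type*) [CommRing R] [AddCommGroup M] [Module R M] : Type _ :=
  Module.Dual R (Module.Dual R M) ⧸ LinearMap.range (Module.Dual.eval R M)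

end ReflexiveDefect

/-! ## Part 5. The hypotheses (Norm), (mod `p`), (Cong) of §1.2 -/

section Hypotheses

variable (W : WeierstrassCurve ℚ) (K : Type u) [Field K] [NumberField K] (p : ℕ) [Fact p.Prime]

/-- **(Norm)** (§1.2/§5.2): "the local norm maps `E(K_{n,v}) → E(K_v)` are surjective for all `n ≥ 1`
and all primes of `K` that do not divide `p`", on the tree's local layer groups
`Kobayashi2003.localLayerPointsOfEmb` at the completion `K_v` (embedding `closureEmb`; all places of
`K_n` above `v` are conjugate) with the local trace `localTraceOfEmb … 0 n = N_{K_{n,v}/K_v}`. (In the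
source (Norm) presupposes (Tam); here the two are separate fields of `ModP`.)
[cite: HatleyLeiVigni2022, §1.2 (Norm) and §5.2] -/
def LocalNormsSurjective (κ : ZpExtension K p) : Prop :=
  ∀ v : HeightOneSpectrum (𝓞 K), ((p : ℕ) : 𝓞 K) ∉ v.asIdeal → ∀ n : ℕ, 1 ≤ n →
    ∀ P ∈ localLayerPointsOfEmb κ (closureEmb (K := K) (v.adicCompletion K)) (W.baseChange K) 0,
      ∃ Q ∈ localLayerPointsOfEmb κ (closureEmb (K := K) (v.adicCompletion K)) (W.baseChange K) n,
        localTraceOfEmb κ (closureEmb (K := K) (v.adicCompletion K)) (W.baseChange K) 0 n Q = P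

/-- **(mod `p`)** for the sign `ε` (§1.2, flag `sign-wise`): "For an elliptic curve `E/ℚ` satisfying both
`a_p(E) = 0` and (Norm), we have `𝔈^±_n ≠ 0` and `Ш^±_p(E, K_{n+1}/K_n) = 0` for all `n ∈ ℕ`" — with
(Tam) "`p` does not divide `#(E/E⁰)`" (no Tamagawa number of `E/ℚ` divisible by `p`,
`WeierstrassCurve.tamagawaProduct`) and (Norm) as fields (the source's cumulative convention
(mod `p`) ⇒ (Norm) ⇒ (Tam)), `𝔈^ε_n = 𝔈^ε_{1,n}` of the Heegner family `F` (`frakE … n 1`) and the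
relative group at `m = 1` (`RelSignedShaVanishes … n 1`; Remark 3.6: the subscript `p` means `m = 1`).
`a_p = 0` is in the `Setting`. A `Prop`-valued structure; nothing is asserted.
[cite: HatleyLeiVigni2022, §1.2 (Tam), (Norm), (mod p) and Remark 5.14] -/
structure ModP (κ : ZpExtension K p) {N : ℕ} [NeZero N] {jbar : AlgebraicClosure K →+* ℂ}
    (F : HeegnerFamily N W K κ jbar) (ε : ℤˣ) : Prop where
  /-- (Tam): `p ∤ ∏ c_ℓ(E/ℚ)`. -/
  tam : ¬ p ∣ W.tamagawaProduct
  /-- (Norm): the local norm maps away from `p` are surjective along the tower. -/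
  norm : LocalNormsSurjective W K p κ
  /-- `Ш^ε_p(E, K_{n+1}/K_n) = 0` for all `n`. -/
  relSha : ∀ n : ℕ, RelSignedShaVanishes (W.baseChange K) p κ ε n 1
  /-- `𝔈^ε_n ≠ 0` for all `n`. -/
  frakE_ne_bot : ∀ n : ℕ, frakE W p κ F ε n 1 ≠ ⊥

/-- **`E_1[p] ≃ E_2[p]` as `G_ℚ`-modules** (the isomorphism clause of (Cong), §1.2/§6.1: "two elliptic
curves `E_1/ℚ` and `E_2/ℚ` are `p`-congruent … if `E_1[p] ≃ E_2[p]` as `G_ℚ`-modules"): a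
`Γ_ℚ`-equivariant group isomorphism between the geometric `p`-torsion subgroups (`geomTorsion`, with the
`Γ_ℚ`-action of `GaloisAction.lean`). [cite: HatleyLeiVigni2022, §1.2 (Cong) and §6.1] -/
def ModPCongruent (W₁ W₂ : WeierstrassCurve ℚ) (p : ℕ) : Prop :=
  ∃ e : geomTorsion W₁ (p : ℤ) ≃+ geomTorsion W₂ (p : ℤ),
    ∀ (σ : absoluteGaloisGroup ℚ) (P : geomTorsion W₁ (p : ℤ)), e (σ • P) = σ • e P

end Hypotheses

/-! ## Part 6. The theorems of Hatley–Lei–Vigni 2022, §5–§6 (named facts; statements only, hypotheses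
as printed PLUS the two proof inputs of flag `HLV-rank-one-input` as explicit binders) -/

section Facts

variable (W : WeierstrassCurve ℚ) [W.IsGloballyMinimal] (K : Type) [Field K] [NumberField K]
  (p : ℕ) [Fact p.Prime] (κ : ZpExtension K p) (𝔭 𝔭' : HeightOneSpectrum (𝓞 K))

/-- **Hatley–Lei–Vigni 2022, Theorem 1.1 = Theorem 5.15 (no proper `Λ`-submodule of finite index).**
Printed: "Suppose that hypothesis (mod `p`) is satisfied. Then `US^±_p(E/K)` is free of rank one over
`ℤ_p` and the `Λ`-module `Sel^±_{p^∞}(E/K_∞)` admits no proper `Λ`-submodule of finite index" (Thm. 1.1: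
"If (Heeg) and (mod `p`) hold, then …"); §1 p. 3: "or, equivalently, … their Pontryagin duals have no
nontrivial finite `Λ`-submodules". Standing (§1.1–1.2): `p` ODD, `E/ℚ` of conductor `N` with good
supersingular reduction at `p` and `a_p(E) = 0`, `K` imaginary quadratic with (Heeg) "every prime number
dividing `Np` splits in `K`", the primes above `p` totally ramified in `K_∞` (here via `p ∤ h_K`,
`Setting`; flag `tot-ram-via-h_K`). TRANSCRIBED for each sign `ε` (flag `sign-wise`) with (mod `p`) =
`ModP … F ε` for a Heegner family `F` (the `z_n` of §4.2, flag `HLV-LV-family`), and WITH TWO EXTRA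
BINDERS that the printed PROOF uses but the printed statement does not display (flag
`HLV-rank-one-input`; the fact is thereby weaker than the printed sentence, never stronger):
`hSha` — "`Ш_{p^m}(E/K)` is finite and bounded independently of `m` ([Kol-Euler])" (proof of Lemma 5.13),
on `Ш^ε_{p^m}(E/K) = signedSha … 0 m` (= `Ш_{p^m}(E/K)`, Lemma 3.7); `hrk` — "by [LV-BUMI] (see also
[CastellaWan]), the `Λ`-module `Sel^±_{p^∞}(E/K_∞)^∨` has rank one" (proof of Thm. 5.15; in print for
`p ≥ 5`: `AcSigned.longoVigni2019_thm14_signedSelmerDual_rank_one`), on every dual datum. Conclusions: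
`US^ε_p(E/K) ≅ ℤ_p` (`UniversalNormsFreeRankOne`), `Sel^ε_{p^∞}(E/K_∞)` has no proper `Γ_K`-stable
subgroup of finite index (`NoProperFiniteIndexSubmodule`), and every finite `Λ`-submodule of every
Pontryagin-dual datum `X^ε` is trivial. Nothing is asserted (`def … : Prop`).
[cite: HatleyLeiVigni2022, Thm. 1.1, Thm. 5.15, Lemma 5.13 and §1.1–1.2] -/
def hatleyLeiVigni2022_thm515_noFiniteIndex : Prop :=
  ∀ (_ : Setting W K p κ 𝔭 𝔭') (N : ℕ) [NeZero N], (W.conductorNorm ℤ : ℕ) = N →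
    SatisfiesHeegnerHypothesis N K →
    ∀ (jbar : AlgebraicClosure K →+* ℂ) (F : HeegnerFamily N W K κ jbar) (γ : absoluteGaloisGroup K),
      κ.IsTopGenerator γ → ∀ (ε : ℤˣ), ModP W K p κ F ε →
    -- `hSha` [Kol-Euler]: `#Ш_{p^m}(E/K)` bounded independently of `m`
    (∃ B : ℕ, ∀ m : ℕ, Finite (signedSha (W.baseChange K) p κ ε 0 m) ∧
      Nat.card (signedSha (W.baseChange K) p κ ε 0 m) ≤ B) →
    -- `hrk` [LV-BUMI]: `X^ε` finitely generated of `Λ`-rank one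
    (∀ D : SignedSelmerDualData (W.baseChange K) κ γ ε,
      Module.Finite (IwasawaAlgebra p) D.X ∧ Module.finrank (IwasawaAlgebra p) D.X = 1) →
    UniversalNormsFreeRankOne (W.baseChange K) p κ γ ε ∧
    NoProperFiniteIndexSubmodule (W.baseChange K) p κ ε ∧
    ∀ (D : SignedSelmerDualData (W.baseChange K) κ γ ε)
      (M : Submodule (IwasawaAlgebra p) D.X), Finite M → M = ⊥

/-- **Hatley–Lei–Vigni 2022, Corollary 5.9.** Printed: "The `Λ`-module `Sel^±_{p^∞}(E/K_∞)` admits no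
proper `Λ`-submodule of finite index if and only if `S^±_p(E/K)/US^±_p(E/K)` has no `ℤ_p`-torsion"
(from the perfect pairing of Thm. 5.8, "as in the proof of [Ber2], which is completely algebraic in
nature"). Standing hypotheses as in `hatleyLeiVigni2022_thm515_noFiniteIndex`; §5.1 "we also assume
that the hypothesis (Tam) holds" and Prop. 5.6/Thm. 5.8 "Suppose that (Norm) holds" are carried as
binders. TRANSCRIBED per sign `ε` on `NoProperFiniteIndexSubmodule` and `UniversalNormsSaturated`
(flags `US-as-limit`, `away-p`). [cite: HatleyLeiVigni2022, Cor. 5.9, Thm. 5.8, §5.1–5.2] -/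
def hatleyLeiVigni2022_cor59_noFiniteIndex_iff_saturated : Prop :=
  ∀ (_ : Setting W K p κ 𝔭 𝔭') (N : ℕ), (W.conductorNorm ℤ : ℕ) = N → SatisfiesHeegnerHypothesis N K →
    ¬ p ∣ W.tamagawaProduct → LocalNormsSurjective W K p κ →
    ∀ (γ : absoluteGaloisGroup K), κ.IsTopGenerator γ → ∀ (ε : ℤˣ),
      NoProperFiniteIndexSubmodule (W.baseChange K) p κ ε ↔
        UniversalNormsSaturated (W.baseChange K) p κ γ ε

/-- **Hatley–Lei–Vigni 2022, Proposition 5.7.** Printed: "There is a canonical isomorphism of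
`Λ`-modules `Ŝ^±_p(E/K_∞) ≃ Hom_Λ(Sel^±_{p^∞}(E/K_∞)^∨, Λ)`" (proof: "as in the proof of [Perrin-Riou],
replacing the control theorem used in [Perrin-Riou] with Proposition 3.9", which needs (Tam)).
Standing hypotheses as above, (Tam) as a binder. TRANSCRIBED per sign `ε`: for `γ` a topological
generator, the compact `Λ`-adic signed module `selmerLambdaAdic … (sgn ε)` with its constructed
`ℤ_p⟦T⟧`-structure `selmerLambdaAdic.moduleOfGen` (`T = γ − 1`) is `Λ`-isomorphic to the `Λ`-dual
`Module.Dual Λ X` of every Pontryagin-dual datum `X = D.X` of `Sel^ε_{p^∞}(E/K_∞)`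
(`Kobayashi2003.SignedSelmerDualData`; "canonical" is not transcribed). The ordinary prototype is
Perrin-Riou 1987 §2.2 Lemme 5 (i). [cite: HatleyLeiVigni2022, Prop. 5.7 and §5.1 (Tam)]
[cite: PerrinRiou1987BSMF, §2.2 Lemme 5 (i)] -/
def hatleyLeiVigni2022_prop57_compactSigned_equiv_dual : Prop :=
  ∀ (_ : Setting W K p κ 𝔭 𝔭') (N : ℕ), (W.conductorNorm ℤ : ℕ) = N → SatisfiesHeegnerHypothesis N K →
    ¬ p ∣ W.tamagawaProduct →
    ∀ (γ : absoluteGaloisGroup K) (hγ : κ.IsTopGenerator γ) (ε : ℤˣ)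
      (D : SignedSelmerDualData (W.baseChange K) κ γ ε),
      letI := selmerLambdaAdic.moduleOfGen (W.baseChange K) p κ γ hγ (fun _ ↦ .sgn ε)
      Nonempty (↥(selmerLambdaAdic (W.baseChange K) p κ γ (fun _ ↦ .sgn ε)) ≃ₗ[IwasawaAlgebra p]
        Module.Dual (IwasawaAlgebra p) D.X)

variable (W₁ W₂ : WeierstrassCurve ℚ) [W₁.IsGloballyMinimal] [W₂.IsGloballyMinimal]

/-- **Hatley–Lei–Vigni 2022, Proposition 6.2 (`p`-congruent curves have the same signed Selmer group
mod `p`).** Printed: "Suppose `E_1/ℚ` and `E_2/ℚ` are elliptic curves satisfying `a_p(E_i) = 0` and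
(Tam) for `i = 1, 2` and that `E_1[p] ≃ E_2[p]` as `G_ℚ`-modules. Assume further that the hypothesis
(Heeg) holds. Then we have an isomorphism `𝒳^±(E_1)/p ≃ 𝒳^±(E_2)/p`", `𝒳^±(E_i) = Sel^±_{p^∞}(E_i/K_∞)^∨`;
§6.3 standing: "we fix elliptic curves `E_1` and `E_2` with square-free conductors `N_1` and `N_2`" and
"(Heeg)" for "the product of the conductors `N_1N_2`" (flags `square-free`, `Heeg-product`); proof via
`Sel^±_p(E_1/K_∞) ≃ Sel^±_p(E_2/K_∞)` (isomorphic local conditions, [kim09], [AhmedLim]) + Prop. 3.9 +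
duality. TRANSCRIBED with both curves in the `Setting` (odd supersingular `p`, `a_p = 0`, `p` split,
anticyclotomic `κ`, `p ∤ h_K`), `ModPCongruent W₁ W₂ p`, and the conclusion as a `Λ`-linear isomorphism
`X^ε(E_1)/pX^ε(E_1) ≃ X^ε(E_2)/pX^ε(E_2)` (`p = IwasawaAlgebra.augIdealP p = (p) ⊂ Λ`) for every pair of
dual data. [cite: HatleyLeiVigni2022, Prop. 6.2 and §6.3 (standing hypotheses)] -/
def hatleyLeiVigni2022_prop62_dual_mod_p : Prop :=
  ∀ (_ : Setting W₁ K p κ 𝔭 𝔭') (_ : Setting W₂ K p κ 𝔭 𝔭') (N₁ N₂ : ℕ),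
    (W₁.conductorNorm ℤ : ℕ) = N₁ → (W₂.conductorNorm ℤ : ℕ) = N₂ → Squarefree N₁ → Squarefree N₂ →
    SatisfiesHeegnerHypothesis (N₁ * N₂) K → ¬ p ∣ W₁.tamagawaProduct → ¬ p ∣ W₂.tamagawaProduct →
    ModPCongruent W₁ W₂ p →
    ∀ (γ : absoluteGaloisGroup K), κ.IsTopGenerator γ → ∀ (ε : ℤˣ)
      (D₁ : SignedSelmerDualData (W₁.baseChange K) κ γ ε)
      (D₂ : SignedSelmerDualData (W₂.baseChange K) κ γ ε),
      Nonempty ((D₁.X ⧸ (IwasawaAlgebra.augIdealP p • (⊤ : Submodule (IwasawaAlgebra p) D₁.X))) ≃ₗ[IwasawaAlgebra p]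
        (D₂.X ⧸ (IwasawaAlgebra.augIdealP p • (⊤ : Submodule (IwasawaAlgebra p) D₂.X))))

/-- **Hatley–Lei–Vigni 2022, Theorem 1.2 = Theorem 6.3 (variation of the signed Iwasawa invariants
among `p`-congruent curves).** Printed: "Let `E_1/ℚ` and `E_2/ℚ` be elliptic curves for which the
hypotheses (Heeg) and (Cong) hold. Then `μ_±(E_1) = 0 ⟺ μ_±(E_2) = 0`. Suppose that
`μ_±(E_1) = μ_±(E_2) = 0`. Then `λ_±(E_1) + c_±(E_1) = λ_±(E_2) + c_±(E_2)`", where (Cong) = "both …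
satisfy (mod `p`), [and] `E_1[p] ≃ E_2[p]`", `μ_±(E_i) = μ(𝒳^±(E_i))`, `λ_±(E_i) = λ(𝒳^±(E_i))`
(§6.2, read off the torsion part: flag `mu-lambda-of-torsion`), `c_±(E_i) = c(𝒳^±(E_i))` with
`|T₂(M)[p]| = |𝔽_p|^{c(M)}` (Def. 6.1; flag `c-invariant`); §6.3 standing (square-free `N_1`, `N_2`;
(Heeg) for `N_1N_2`; (Tam); `a_p = 0`). Printed proof inputs carried as binders (flag
`HLV-rank-one-input`): "By [LV-BUMI], both `𝒳_±(E_i)` have `Λ`-rank 1" (`hrk₁`, `hrk₂`) and, through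
"Theorem 5.15 (and duality)", Lemma 5.13's [Kol-Euler] bound (`hSha₁`, `hSha₂`). TRANSCRIBED per sign
`ε` for every pair of dual data `D₁`, `D₂`, with `μ = muInvariant p (X_tors)`, `λ = lambdaInvariant p
(X_tors)` and `c_i` any naturals with `#T₂(D_i.X)[p] = p^{c_i}` (`reflexiveDefect`).
[cite: HatleyLeiVigni2022, Thm. 1.2, Thm. 6.3, Def. 6.1 and §6.2–6.3] -/
def hatleyLeiVigni2022_thm63_invariants_congruent : Prop :=
  ∀ (_ : Setting W₁ K p κ 𝔭 𝔭') (_ : Setting W₂ K p κ 𝔭 𝔭') (N₁ N₂ : ℕ) [NeZero N₁] [NeZero N₂],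
    (W₁.conductorNorm ℤ : ℕ) = N₁ → (W₂.conductorNorm ℤ : ℕ) = N₂ → Squarefree N₁ → Squarefree N₂ →
    SatisfiesHeegnerHypothesis (N₁ * N₂) K → ModPCongruent W₁ W₂ p →
    ∀ (jbar : AlgebraicClosure K →+* ℂ) (F₁ : HeegnerFamily N₁ W₁ K κ jbar)
      (F₂ : HeegnerFamily N₂ W₂ K κ jbar) (γ : absoluteGaloisGroup K), κ.IsTopGenerator γ → ∀ (ε : ℤˣ),
    ModP W₁ K p κ F₁ ε → ModP W₂ K p κ F₂ ε →
    -- `hSha₁`, `hSha₂` [Kol-Euler]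
    (∃ B : ℕ, ∀ m : ℕ, Finite (signedSha (W₁.baseChange K) p κ ε 0 m) ∧
      Nat.card (signedSha (W₁.baseChange K) p κ ε 0 m) ≤ B) →
    (∃ B : ℕ, ∀ m : ℕ, Finite (signedSha (W₂.baseChange K) p κ ε 0 m) ∧
      Nat.card (signedSha (W₂.baseChange K) p κ ε 0 m) ≤ B) →
    ∀ (D₁ : SignedSelmerDualData (W₁.baseChange K) κ γ ε)
      (D₂ : SignedSelmerDualData (W₂.baseChange K) κ γ ε),
    -- `hrk₁`, `hrk₂` [LV-BUMI]
    Module.Finite (IwasawaAlgebra p) D₁.X ∧ Module.finrank (IwasawaAlgebra p) D₁.X = 1 →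
    Module.Finite (IwasawaAlgebra p) D₂.X ∧ Module.finrank (IwasawaAlgebra p) D₂.X = 1 →
    (muInvariant p ↥(Submodule.torsion (IwasawaAlgebra p) D₁.X) = 0 ↔
      muInvariant p ↥(Submodule.torsion (IwasawaAlgebra p) D₂.X) = 0) ∧
    (muInvariant p ↥(Submodule.torsion (IwasawaAlgebra p) D₁.X) = 0 →
      muInvariant p ↥(Submodule.torsion (IwasawaAlgebra p) D₂.X) = 0 →
      ∀ c₁ c₂ : ℕ,
        Nat.card ↥(AddSubgroup.torsionBy (reflexiveDefect (IwasawaAlgebra p) D₁.X) (p : ℤ)) = p ^ c₁ →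
        Nat.card ↥(AddSubgroup.torsionBy (reflexiveDefect (IwasawaAlgebra p) D₂.X) (p : ℤ)) = p ^ c₂ →
        lambdaInvariant p ↥(Submodule.torsion (IwasawaAlgebra p) D₁.X) + c₁ =
          lambdaInvariant p ↥(Submodule.torsion (IwasawaAlgebra p) D₂.X) + c₂)

end Facts

end Literature.NumberTheory.EllipticCurves.AcSigned

end
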